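import Literature.MathematicalPhysics.QuantumFieldTheory.Balaban1983to89.B7Eq162General
import Literature.MathematicalPhysics.QuantumFieldTheory.Balaban1983to89.B7Eq167Flat

/-!
# `Balaban1983to89.B7Eq167General` — T. Bałaban, *Averaging operations for lattice gauge theories*, Commun. Math.
# Phys. **98** (1985) 17–51 [Balaban1985Averaging], Sect. F p. 43: *"the functions u given by the formulas (104)–(106) …
# satisfy other conditions following from (107), (108) if the configuration U₁ is small"* — the membership of the
# gauge fixing (104)–(106) in the class `Λ_k(U₀, α₃)` (166)–(167) PROVED AT A GENERAL REGULAR BACKGROUND `U₀`, with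
# the explicit `α₃ = 40d·L^k b` (`b ↔ α₁η`): `B7Eq167Flat`'s flat certificate (`U₀ = 1`) lifted to the regime of
# Proposition 2 / (52), using the general-background Propositions 3–4 now in the tree (`B7Eq123General`,
# `B7Eq162General.level_facts`, `B7Prop3GeneralAnalytic`)

statement-level skeleton of published theorems with citation tags; proofs where landed; nothing here is a claim
about the Yang–Mills mass gap

PDF held: `paper:balaban1985-cmp98-averaging` (journal page = PDF page + 16); pp. 43–44 [PDF 27–28] READ AS IMAGES on
the x2 renders `run/shared/lean/pub/pub-balaban/b2b-balaban-ref1/pages/1985-cmp98-averaging/1985-cmp98-averaging-p027-x2.png`,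
`…-p028-x2.png` (this seat, 2026-08-21); (104)–(108) p. 33 as quoted and kernel-certified in `B7Eq106Concrete`.

WHAT IS REPRODUCED.  SKELETON row **B7.Eq165** ((165)–(167) pp. 43–44; rows of record `lit-balaban-r04/ROWS-B7.md`:
«typed-existing (+kernel pieces proved: @flat membership certificate for the gauge fixing)», decls `B7Eq167Flat.Reg165`,
`.Cond166`, `.Cond167`, `.InLambda`, `.inLambda_flat`), mega-formalization `lit-balaban` (HOME
`run/shared/lean/pub/lit-balaban/`), Phase-2 proof seat `p29` gen 6 (unit `lit-balaban-p29`), fourth file of the gen.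
THE PRINTED TEXT (p. 43, verbatim from the render): *"In the last section of the paper we will study the averaging
operations for gauge transformations, given by (61), (78)–(80). A natural analog of the regularity condition (52) would
be the condition |(∂_{U₀}u)(b)| = |R(U_{0,b})u(b₊) − u(b₋)| < α₀η, b ⊂ Ω. (165) We will consider functions u satisfying
this condition, but we have to consider also the functions u given by the formulas (104)–(106). They appear naturally
in our considerations and generally they do not satisfy the regularity condition (165), but they satisfy other
conditions following from (107), (108) if the configuration U₁ is small, i.e., |U₁ − 1| < α₁η, α₁ small. We define:"*
and p. 44: *"Λ_k(U₀, α₃) is a set of gauge transformations u defined on Ω, and satisfying the conditions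
|(\overline{R₀u^j})(x_j) − 1| < α₃, x_j ∈ Ω^{(j)}, j = 0, 1, …, k, (166)
|(\overline{R₀u^j})⁻¹(x_{j+1})(R̄^j_{0,x_{j+1}}\overline{R₀u^j})(x_j) − 1| < α₃L^{j+1}η, x_{j+1} ∈ Ω^{(j+1)}, x_j ∈ B(x_{j+1}),
j = 0, 1, …, k − 1. (167)"*.

WHAT THE TREE HAD.  `B7Eq167Flat` typed (165)–(167) and the class `Λ_k(U₀, α₃)` over the concrete Sect. C objects at an
ARBITRARY background (`Cond166`, `Cond167`, `InLambda`), and CERTIFIED the quoted sentence at the FLAT background only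
(`inLambda_flat`, `inLambda_glev_flat`: every solution of (67) + (81) at `U₀ = 1`, `U₁ = e^{B}`, `|B| ≤ b`, lies in
`Λ_k(1, 72d·L^k b)`), recording as its READING (f): *"At a curved background U₀ satisfying (52) the same two-line argument
needs Props 3–6 there ((111)–(112) and (161) at U₀), which the tree carries only as printed statements — NOT CLAIMED"*.
Since then the general-background Propositions 3–4 have landed (seat p06 gen 2: `B7Eq112General`, `B7Eq123General`,
`B7Eq162General`; the analytic one-step bounds `B7Prop3GeneralAnalytic`).  THIS FILE closes READING (f).

WHAT THIS FILE PROVES (kernel, 0 sorry, theorems only; the companions are used BY NAME, nothing is restated).  Regime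
(the «α₀, α₁ sufficiently small» of Props 2–6 made explicit, exactly the hypothesis list of `B7Eq162General.level_facts`):
`L ≥ 2`; `U₀` with values in an averaging-closed subgroup `G ⊂ U1 = {|u| ≤ 1, |u⁻¹| ≤ 1}` (`B7Prop2Explicit.AvgClosed`;
`U(N)`, `SU(N)`); Prop. 2's `0 < α₀`, `C₀α₀ ≤ ⅓`, `4α₀ ≤ c₂′(d, L)` and (52) `sup_p |U₀(∂p) − 1| < α₀L^{−2k}`; `U₁ = e^{B}` bondwise
with `|B| ≤ b` and the (123)-route smallness `e^{3200(d+1)²(d+4)α₀}(1 + 8·131072(d+1)²·L^k b) ≤ 2`, `2L^k b ≤ c₃(d, L)`, plus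
`128d·L^k b ≤ 1`.  Then for EVERY solution `u` of the gauge conditions (67) (levels `< k`) + (81) (level `k`) — in particular
the gauge fixing (104)–(106), `B7Eq84Concrete.glev` —
* §1 `telUp_mem_U1`: the telescoped background transporters `Ū₀^i(Γ^{(n)}_{x_{i+n},x_i})` of (101)–(107) are unit-bounded;
* §2 (generic one-level bounds at a unit-bounded background `V₀`, field `e^{A}`, `|A| ≤ a`, `θ ≥ dL·a`, `θ ≤ 1/64`):
  `norm_tHol_treeWord_sub_one_le` — the twisted transport (58) along a block tree contour is within `e^{dL·a} − 1` of `1`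
  (`B7Prop3GeneralAnalytic.norm_tHol_expCfg_sub_one_le`); `one_add_norm_wframe_inv_sub_one_le` — the inverse block frame
  (82)/(110) is within `e^{4θ} − 1` of `1` (`norm_Fcov_le_of_tHol`: `|F| ≤ 2·max|transport − 1| ≤ 4θ`);
  `norm_conj_frameInv_mul_transport_sub_one_le` — a level factor of (106)/(107), `R(T)⁻¹[(frame)⁻¹·(transport)]` with `T`
  unit-bounded, is within `e^{5θ} − 1` of `1`;
* §3 the tower: `norm_levelFactor_general` (the level-`m` factor of (107), `m = j + i < k`, is within `e^{5θ_m} − 1` of `1`,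
  `θ_m = 2d·L^{m+1}b` = `B7Eq167Flat.theta`, fed by (161) general `|log U̿^m| ≤ 2L^m b` and the unit-boundedness of `Ū₀^m`,
  both from `B7Eq162General.level_facts`); **`cond166_general`** — (166) with `α₃ = e^{20d·L^k b} − 1` (by (107)
  `B7Eq106Concrete.eq107` and `Σ_{m=j}^{k−1} 5θ_m ≤ 20d·L^k b`); **`cond167_general`** — (167) with the right-hand side
  `e^{θ_j} − 1` (by (108) `B7Eq106Concrete.eq108`: the expression IS the transport of `U̿^j` along `Γ_{x_{j+1},x_j}`);
  **`inLambda_general`** — `u ∈ Λ_k(U₀, 40d·L^k b)` with `η = L^{−k}`; **`inLambda_glev_general`** — the same for the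
  constructed gauge fixing `glev`; **`norm_sub_one_le_of_gaugeFixing`** / **`norm_glev_sub_one_le`** — (166) at `j = 0`:
  `|u(x) − 1| ≤ 40d·L^k b` at every site (the form in which [Balaban1989LargeFieldI] (1.37) and [Balaban1988Convergent]
  (3.19) consume «(106)–(108) [12]»: the gauge transformation of a small field `e^{B}`, `L^k b = sup` of the exponent in
  lattice units, is within `O(1)·L^k b` of `1`); `inLambda_general_eta` — print's letters (`L^kη = 1`, `|B| ≤ α₁η`:
  `u ∈ Λ_k(U₀, 40d·α₁)`).

MODEL / DECLARED DEVIATIONS (referee columns F6/F7), as in `B7Eq167Flat` READINGS (a)–(e),(g) and `B7Eq162General`: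
(M1) `Ω ↦ ℤ^d` per level; values in a complete normed `ℂ`-algebra `𝔸` with `‖1‖ = 1`; `G ⊂ U1` averaging-closed; `<` typed
`≤`.  (M2) «U₁ small, |U₁ − 1| < α₁η» read in the exponential form (109) `U₁ = e^{B}`, `|B| ≤ b` (`b ↔ α₁η`), the form of
Props 3–6 in the tree.  (M3) Constants explicit and merely sufficient: `40d` (flat file: `72d`, from the cruder frame
constant `8θ` of `B7Prop3Flat.frame_estimate`; here `|F| ≤ 4θ` directly from `norm_Fcov_le_of_tHol`); the smallness list is
that of `level_facts` ((123)-route) plus `128d·L^k b ≤ 1` (so that every `θ_m ≤ 1/64`, `m < k`).  (M4) The background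
rotations `R(Ū₀^i(Γ))⁻¹` of (106)/(107), trivial at `U₀ = 1`, are unit-ball conjugations here (`|T⁻¹XT − 1| ≤ |X − 1|` for
`T ∈ U1`) — the only new ingredient of the lift besides the general-background inputs.  Net new unproved facts: 0 (no `def`).
-/

noncomputable section

open scoped BigOperators
open NormedSpace Finset

namespace Literature.MathematicalPhysics.QuantumFieldTheory.Balaban1983to89.B7Eq167General

open B7Prop1Explicit B7Prop2Explicit B7Prop3Flat B7Eq92Concrete B7Eq99Concrete B7Eq84Concrete B7Eq106Concrete
open B7Prop3GeneralAnalytic (norm_tHol_expCfg_sub_one_le norm_Fcov_le_of_tHol)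
open B7Eq162General (level_facts)
open B7Eq167Flat
open B8Ineq130 (fl)

-- `Site` alone could resolve to the torus sites of `Setup.lean` through a parent namespace; re-export the `ℤ^d`
-- sites of `B7Prop1Explicit`.
export B7Prop1Explicit (Site)

variable {d : ℕ}
variable {𝔸 : Type*} [NormedRing 𝔸] [NormedAlgebra ℂ 𝔸] [CompleteSpace 𝔸] [NormOneClass 𝔸]

/-! ## §1 The telescoped background transporters are unit-bounded -/

/-- `Ū₀^i(Γ^{(n)}_{x_{i+n},x_i}) ∈ U1` as soon as the averaged backgrounds `Ū₀^m`, `m < i + n`, are unit-bounded (a product of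
block tree transports of `Ū₀^{i}, …, Ū₀^{i+n−1}`). [cite: Balaban1985Averaging, p.29 (display before (77)), (107) p.33] -/
theorem telUp_mem_U1 {L : ℕ} (hL : 1 ≤ L) {U₀ : Site d → Fin d → 𝔸ˣ} (i : ℕ) :
    ∀ n : ℕ, (∀ m < i + n, ∀ x κ, avgIter L U₀ m x κ ∈ U1 𝔸) → ∀ x : Site d, telUp L hL U₀ i n x ∈ U1 𝔸
  | 0, _, x => by rw [telUp_zero]; exact (U1 𝔸).one_mem
  | n + 1, h, x => by
    rw [telUp_succ]
    exact (U1 𝔸).mul_mem (hol_mem (h (i + n) (by omega)) _ _)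
      (telUp_mem_U1 hL i n (fun m hm => h m (by omega)) x)

/-! ## §2 Generic one-level bounds at a unit-bounded background -/

/-- **Transport bound.**  At a unit-bounded background `V₀`, for `V₁ = e^{A}` with `|A| ≤ a`: the twisted transport (58)
`(R_{0,y}V₁)(Γ_{y,x})` along a block tree contour (`x = y + r`, `r ∈ [0, L)^d`, length `≤ dL`) is within `e^{dL·a} − 1` of `1`.
[cite: Balaban1985Averaging, (58) p.27, (108) p.33, (161) p.42] -/
theorem norm_tHol_treeWord_sub_one_le {L : ℕ} {V₀ : Site d → Fin d → 𝔸ˣ} (hV₀ : ∀ x κ, V₀ x κ ∈ U1 𝔸)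
    (A : Site d → Fin d → 𝔸) {a : ℝ} (ha : 0 ≤ a) (hA : ∀ x κ, ‖A x κ‖ ≤ a) (y : Site d) (r : Fin d → Fin L) :
    ‖((tHol V₀ (expCfg A) y (treeWord (boxVec L r)) : 𝔸ˣ) : 𝔸) - 1‖ ≤ Real.exp (((d * L : ℕ) : ℝ) * a) - 1 := by
  refine (norm_tHol_expCfg_sub_one_le hV₀ A hA _ y).trans (sub_le_sub_right (Real.exp_le_exp.mpr ?_) 1)
  have hlen : (((treeWord (boxVec L r)).length : ℕ) : ℝ) ≤ ((d * L : ℕ) : ℝ) := by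
    exact_mod_cast (show (treeWord (boxVec L r)).length ≤ d * L by rw [length_treeWord]; exact l1_boxVec_le L r)
  exact mul_le_mul_of_nonneg_right hlen ha

/-- **Frame bound.**  At a unit-bounded background `V₀`, for `V₁ = e^{A}`, `|A| ≤ a`, `dL·a ≤ θ ≤ 1/64`: the INVERSE block
frame `(\overline{R_{0,y}V₁})⁻¹ = exp(−F(y))` ((82)/(110): `F(y) = Σ_{x∈B(y)} L^{−d} log (R_{0,y}V₁)(Γ_{y,x})`) satisfies
`1 + |(\overline{R_{0,y}V₁})⁻¹ − 1| ≤ e^{4θ}` (`|F| ≤ 2·max_x|(R_{0,y}V₁)(Γ_{y,x}) − 1| ≤ 4θ`). [cite: Balaban1985Averaging, (110)–(112) p.34, (82) p.30] -/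
theorem one_add_norm_wframe_inv_sub_one_le {L : ℕ} (hL : 1 ≤ L) {V₀ : Site d → Fin d → 𝔸ˣ} (hV₀ : ∀ x κ, V₀ x κ ∈ U1 𝔸)
    (A : Site d → Fin d → 𝔸) {a θ : ℝ} (ha : 0 ≤ a) (hA : ∀ x κ, ‖A x κ‖ ≤ a) (hθ : ((d * L : ℕ) : ℝ) * a ≤ θ)
    (hθ0 : 0 ≤ θ) (hθ1 : θ ≤ 1 / 64) (y : Site d) :
    1 + ‖((((wframe L V₀ (expCfg A) y)⁻¹ : 𝔸ˣ) : 𝔸)) - 1‖ ≤ Real.exp (4 * θ) := by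
  have hτ : ∀ r : Fin d → Fin L, ‖((tHol V₀ (expCfg A) y (treeWord (boxVec L r)) : 𝔸ˣ) : 𝔸) - 1‖ ≤ 2 * θ :=
    fun r => (norm_tHol_treeWord_sub_one_le hV₀ A ha hA y r).trans (exp_sub_one_le_of_le hθ hθ0 hθ1)
  have hF : ‖Fcov L V₀ (expCfg A) y‖ ≤ 2 * (2 * θ) := norm_Fcov_le_of_tHol hL V₀ (expCfg A) y hτ (by linarith)
  have hF' : ‖-Fcov L V₀ (expCfg A) y‖ ≤ 4 * θ := by rw [norm_neg]; linarith
  rw [wframe, val_inv_expUnit, val_expUnit]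
  linarith [(norm_exp_sub_one_le_of_norm_le hF').1]

/-- **A level factor of (106)/(107).**  At a unit-bounded background `V₀`, field `e^{A}`, `|A| ≤ a`, `dL·a ≤ θ ≤ 1/64`, and for
a unit-bounded `T` (the telescoped background transporter): `|R(T)⁻¹[(\overline{R_{0,y}V₁})⁻¹(R_{0,y}V₁)(Γ_{y,x})] − 1| ≤
e^{5θ} − 1` (the rotation `R(T)⁻¹ = R(T⁻¹)` is a unit-ball conjugation; frame `e^{4θ}`, transport `e^{θ}`).
[cite: Balaban1985Averaging, (106)–(107) p.33, (56)–(57) p.27] -/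
theorem norm_conj_frameInv_mul_transport_sub_one_le {L : ℕ} (hL : 1 ≤ L) {V₀ : Site d → Fin d → 𝔸ˣ}
    (hV₀ : ∀ x κ, V₀ x κ ∈ U1 𝔸) (A : Site d → Fin d → 𝔸) {a θ : ℝ} (ha : 0 ≤ a) (hA : ∀ x κ, ‖A x κ‖ ≤ a)
    (hθ : ((d * L : ℕ) : ℝ) * a ≤ θ) (hθ0 : 0 ≤ θ) (hθ1 : θ ≤ 1 / 64) {T : 𝔸ˣ} (hT : T ∈ U1 𝔸) (y : Site d)
    (r : Fin d → Fin L) :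
    ‖((Rc T⁻¹ ((wframe L V₀ (expCfg A) y)⁻¹ * tHol V₀ (expCfg A) y (treeWord (boxVec L r))) : 𝔸ˣ) : 𝔸) - 1‖
      ≤ Real.exp (5 * θ) - 1 := by
  simp only [Rc_apply, inv_inv, Units.val_mul]
  refine (norm_units_inv_conj_sub_one_le hT _).trans ?_
  have ht : 1 + ‖((tHol V₀ (expCfg A) y (treeWord (boxVec L r)) : 𝔸ˣ) : 𝔸) - 1‖ ≤ Real.exp θ := by
    have h := norm_tHol_treeWord_sub_one_le hV₀ A ha hA y r
    linarith [Real.exp_le_exp.mpr hθ]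
  rw [show 5 * θ = 4 * θ + θ by ring]
  exact norm_mul_sub_one_le_exp (one_add_norm_wframe_inv_sub_one_le hL hV₀ A ha hA hθ hθ0 hθ1 y) ht

/-! ## §3 The tower at a general regular background -/

section Tower

variable {L : ℕ} {G : Subgroup 𝔸ˣ} {k : ℕ} {U₀ : Site d → Fin d → 𝔸ˣ} {α₀ : ℝ} {B : Site d → Fin d → 𝔸} {b : ℝ}

/-- **The level-`m` factor of (107) at a general regular background** (`m = j + i < k`): within `e^{5θ_m} − 1` of `1`,
`θ_m = 2d·L^{m+1}b` — §2 at the background `Ū₀^m` (unit-bounded) with the field `U̿^m = e^{log U̿^m}`, `|log U̿^m| ≤ 2L^m b`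
((161) general, `B7Eq162General.level_facts`), and `T = Ū₀^j(Γ^{(i+1)}_{x_{j+i+1},x_j})` unit-bounded (§1).
[cite: Balaban1985Averaging, (107) p.33, (161) p.42] -/
theorem norm_levelFactor_general (hL : 2 ≤ L) (hG : AvgClosed d L G) (hU₀ : ∀ x κ, U₀ x κ ∈ G) (hα : 0 < α₀)
    (hα3 : C0 d * α₀ ≤ 1 / 3) (hα4 : 4 * α₀ ≤ c2' d L) (h52 : pdev U₀ < α₀ * (((L : ℝ) ^ k)⁻¹) ^ 2)
    (hb : 0 ≤ b) (hB : ∀ x κ, ‖B x κ‖ ≤ b)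
    (hsmall : Real.exp (4 * (800 * ((d : ℝ) + 1) ^ 2 * ((d : ℝ) + 4)) * α₀)
      * (1 + 8 * (131072 * ((d : ℝ) + 1) ^ 2) * ((L : ℝ) ^ k * b)) ≤ 2)
    (hc₃ : 2 * ((L : ℝ) ^ k * b) ≤ c3 d L) (hs : 128 * (d : ℝ) * ((L : ℝ) ^ k * b) ≤ 1)
    (hL1 : 1 ≤ L) {j i : ℕ} (hji : j + i < k) (x : Site d) :
    ‖((Rc (telUp L hL1 U₀ j (i + 1) x)⁻¹
        ((lvFr L U₀ (expCfg B) (j + i) x)⁻¹ * lvDbT L hL1 U₀ (expCfg B) (j + i) x) : 𝔸ˣ) : 𝔸) - 1‖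
      ≤ Real.exp (5 * theta d L b (j + i)) - 1 := by
  obtain ⟨hV, hW, hQ⟩ := level_facts hL hG hU₀ hα hα3 hα4 h52 hb hB hsmall hc₃ (j + i) hji.le
  have hT : telUp L hL1 U₀ j (i + 1) x ∈ U1 𝔸 :=
    telUp_mem_U1 hL1 j (i + 1)
      (fun m hm => (level_facts hL hG hU₀ hα hα3 hα4 h52 hb hB hsmall hc₃ m (by omega)).1) x
  have ha : (0 : ℝ) ≤ 2 * ((L : ℝ) ^ (j + i) * b) := by positivity
  simp only [lvFr, lvDbT, hW]
  exact norm_conj_frameInv_mul_transport_sub_one_le hL1 hV _ ha hQ (le_of_eq (by rfl))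
    (theta_nonneg d L hb (j + i)) (theta_le_of_lt d hL1 hb hji hs) hT _ _

/-- **(166) AT A GENERAL REGULAR BACKGROUND** for the gauge fixing: every solution `u` of (67) + (81) relative to `U₀`,
`U₁ = e^{B}`, `|B| ≤ b` (regime of the header) satisfies `|(\overline{R₀u}^j)(x_j) − 1| ≤ e^{20d·L^k b} − 1` for all `j ≤ k`
and all level-`j` sites — by (107) (`B7Eq106Concrete.eq107`), the level factor bounds and `Σ_{m=j}^{k−1} 5θ_m ≤ 20d·L^k b`.
[cite: Balaban1985Averaging, (166) p.44, (107) p.33, (161) p.42] -/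
theorem cond166_general (hL : 2 ≤ L) (hG : AvgClosed d L G) (hU₀ : ∀ x κ, U₀ x κ ∈ G) (hα : 0 < α₀)
    (hα3 : C0 d * α₀ ≤ 1 / 3) (hα4 : 4 * α₀ ≤ c2' d L) (h52 : pdev U₀ < α₀ * (((L : ℝ) ^ k)⁻¹) ^ 2)
    (hb : 0 ≤ b) (hB : ∀ x κ, ‖B x κ‖ ≤ b)
    (hsmall : Real.exp (4 * (800 * ((d : ℝ) + 1) ^ 2 * ((d : ℝ) + 4)) * α₀)
      * (1 + 8 * (131072 * ((d : ℝ) + 1) ^ 2) * ((L : ℝ) ^ k * b)) ≤ 2)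
    (hc₃ : 2 * ((L : ℝ) ^ k * b) ≤ c3 d L) (hs : 128 * (d : ℝ) * ((L : ℝ) ^ k * b) ≤ 1)
    {u : Site d → 𝔸ˣ} (hax : B7Eq84Concrete.AxialGauge L U₀ (expCfg B) u k) (h81 : ∀ z : Site d, uavg L U₀ u k z = 1) :
    Cond166 L U₀ u k (Real.exp (20 * d * ((L : ℝ) ^ k * b)) - 1) := by
  intro j hj z
  have hL1 : 1 ≤ L := le_trans (by norm_num) hL
  rw [← iterate_fl_pow_smul L hL1 j z, eq107 L hL1 U₀ (expCfg B) hax h81 hj]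
  refine (norm_dprod_sub_one_le _ (fun i => 5 * theta d L b (j + i)) (k - j) fun i hi =>
    norm_levelFactor_general hL hG hU₀ hα hα3 hα4 h52 hb hB hsmall hc₃ hs hL1 (by omega) _).trans ?_
  refine sub_le_sub_right (Real.exp_le_exp.mpr ?_) 1
  have hL2 : (2 : ℝ) ≤ L := by exact_mod_cast hL
  calc ∑ i ∈ range (k - j), 5 * theta d L b (j + i)
      = 10 * d * b * ∑ i ∈ range (k - j), (L : ℝ) ^ (j + i + 1) := by
        rw [mul_sum]; exact sum_congr rfl fun i _ => by rw [theta_eq]; ring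
    _ ≤ 10 * d * b * (2 * (L : ℝ) ^ (j + (k - j))) :=
        mul_le_mul_of_nonneg_left (sum_pow_succ_le hL2 j (k - j)) (by positivity)
    _ = 20 * d * ((L : ℝ) ^ k * b) := by rw [Nat.add_sub_cancel' hj]; ring

/-- **(167) AT A GENERAL REGULAR BACKGROUND** for the gauge fixing: every solution `u` of (67) relative to `U₀`, `U₁ = e^{B}`,
`|B| ≤ b` (regime of the header) satisfies (167) with the right-hand side `e^{θ_j} − 1`, `θ_j = 2d·L^{j+1}b`: by (108)
(`B7Eq106Concrete.eq108`) the expression of (167) IS the twisted transport `(R̄^j_{0,x_{j+1}}U̿^j)(Γ_{x_{j+1},x_j})` of the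
`j`-fold double average, and (161) general gives `|log U̿^j| ≤ 2L^j b` (§2 transport bound) — print's factor `L^{j+1}η` is the
growth `L^j` times the contour scale `L`. [cite: Balaban1985Averaging, (167) p.44, (108) p.33, (161) p.42] -/
theorem cond167_general (hL : 2 ≤ L) (hG : AvgClosed d L G) (hU₀ : ∀ x κ, U₀ x κ ∈ G) (hα : 0 < α₀)
    (hα3 : C0 d * α₀ ≤ 1 / 3) (hα4 : 4 * α₀ ≤ c2' d L) (h52 : pdev U₀ < α₀ * (((L : ℝ) ^ k)⁻¹) ^ 2)
    (hb : 0 ≤ b) (hB : ∀ x κ, ‖B x κ‖ ≤ b)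
    (hsmall : Real.exp (4 * (800 * ((d : ℝ) + 1) ^ 2 * ((d : ℝ) + 4)) * α₀)
      * (1 + 8 * (131072 * ((d : ℝ) + 1) ^ 2) * ((L : ℝ) ^ k * b)) ≤ 2)
    (hc₃ : 2 * ((L : ℝ) ^ k * b) ≤ c3 d L)
    {u : Site d → 𝔸ˣ} (hax : B7Eq84Concrete.AxialGauge L U₀ (expCfg B) u k) :
    ∀ j < k, ∀ (z : Site d) (r : Fin d → Fin L),
      ‖(((uavg L U₀ u j ((L : ℤ) • z))⁻¹
          * Rc (hol (avgIter L U₀ j) ((L : ℤ) • z) (treeWord (boxVec L r)))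
              (uavg L U₀ u j ((L : ℤ) • z + boxVec L r)) : 𝔸ˣ) : 𝔸) - 1‖
        ≤ Real.exp (theta d L b j) - 1 := by
  intro j hj z r
  obtain ⟨hV, hW, hQ⟩ := level_facts hL hG hU₀ hα hα3 hα4 h52 hb hB hsmall hc₃ j hj.le
  have ha : (0 : ℝ) ≤ 2 * ((L : ℝ) ^ j * b) := by positivity
  rw [eq108 L U₀ (expCfg B) hax hj z r, hW]
  exact norm_tHol_treeWord_sub_one_le hV _ ha hQ _ r

/-- **THE GAUGE FIXING LIES IN `Λ_k(U₀, α₃)` AT A GENERAL REGULAR BACKGROUND** — p. 43: the functions `u` "given by the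
formulas (104)–(106) … satisfy other conditions following from (107), (108) if the configuration `U₁` is small", made
quantitative: in the regime of the header, EVERY solution `u` of (67) + (81) relative to `U₀`, `U₁ = e^{B}`, `|B| ≤ b`
satisfies (166)–(167) with `α₃ = 40d·L^k b` and `η = L^{−k}`: `u ∈ Λ_k(U₀, 40d·L^k b)`.
[cite: Balaban1985Averaging, p.43 (Sect. F, paragraph after (165)), (166)–(167) p.44] -/
theorem inLambda_general (hL : 2 ≤ L) (hG : AvgClosed d L G) (hU₀ : ∀ x κ, U₀ x κ ∈ G) (hα : 0 < α₀)
    (hα3 : C0 d * α₀ ≤ 1 / 3) (hα4 : 4 * α₀ ≤ c2' d L) (h52 : pdev U₀ < α₀ * (((L : ℝ) ^ k)⁻¹) ^ 2)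
    (hb : 0 ≤ b) (hB : ∀ x κ, ‖B x κ‖ ≤ b)
    (hsmall : Real.exp (4 * (800 * ((d : ℝ) + 1) ^ 2 * ((d : ℝ) + 4)) * α₀)
      * (1 + 8 * (131072 * ((d : ℝ) + 1) ^ 2) * ((L : ℝ) ^ k * b)) ≤ 2)
    (hc₃ : 2 * ((L : ℝ) ^ k * b) ≤ c3 d L) (hs : 128 * (d : ℝ) * ((L : ℝ) ^ k * b) ≤ 1)
    {u : Site d → 𝔸ˣ} (hax : B7Eq84Concrete.AxialGauge L U₀ (expCfg B) u k) (h81 : ∀ z : Site d, uavg L U₀ u k z = 1) :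
    InLambda L U₀ u k (40 * d * ((L : ℝ) ^ k * b)) (((L : ℝ) ^ k)⁻¹) := by
  have hL1 : 1 ≤ L := le_trans (by norm_num) hL
  have hLk : (0 : ℝ) < (L : ℝ) ^ k := by positivity
  have ht0 : (0 : ℝ) ≤ d * ((L : ℝ) ^ k * b) := by positivity
  refine ⟨fun j hj z => (cond166_general hL hG hU₀ hα hα3 hα4 h52 hb hB hsmall hc₃ hs hax h81 j hj z).trans ?_,
    fun j hj z r => (cond167_general hL hG hU₀ hα hα3 hα4 h52 hb hB hsmall hc₃ hax j hj z r).trans ?_⟩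
  · have := exp_sub_one_le_two_mul_of_le (x := 20 * d * ((L : ℝ) ^ k * b)) (by positivity) le_rfl (by linarith)
    linarith
  · have hθ1 : theta d L b j ≤ 1 := by linarith [theta_le_of_lt d hL1 hb hj hs]
    refine (exp_sub_one_le_two_mul_of_le (theta_nonneg d L hb j) le_rfl hθ1).trans ?_
    rw [theta_eq, show 40 * (d : ℝ) * ((L : ℝ) ^ k * b) * (L : ℝ) ^ (j + 1) * ((L : ℝ) ^ k)⁻¹
      = 40 * d * b * (L : ℝ) ^ (j + 1) * ((L : ℝ) ^ k * ((L : ℝ) ^ k)⁻¹) by ring, mul_inv_cancel₀ hLk.ne', mul_one]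
    have : (0 : ℝ) ≤ d * b * (L : ℝ) ^ (j + 1) := by positivity
    linarith

/-- **The constructed gauge fixing** `u = glev … k 0` of `B7Eq84Concrete` (the unique solution of (67) + (81), formulas
(104)–(106)) at a general regular background, `U₁ = e^{B}`: `u ∈ Λ_k(U₀, 40d·L^k b)` (`η = L^{−k}`).
[cite: Balaban1985Averaging, p.43 (Sect. F, paragraph after (165)), (104)–(106) p.33, (166)–(167) p.44] -/
theorem inLambda_glev_general (hL : 2 ≤ L) (hG : AvgClosed d L G) (hU₀ : ∀ x κ, U₀ x κ ∈ G) (hα : 0 < α₀)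
    (hα3 : C0 d * α₀ ≤ 1 / 3) (hα4 : 4 * α₀ ≤ c2' d L) (h52 : pdev U₀ < α₀ * (((L : ℝ) ^ k)⁻¹) ^ 2)
    (hb : 0 ≤ b) (hB : ∀ x κ, ‖B x κ‖ ≤ b)
    (hsmall : Real.exp (4 * (800 * ((d : ℝ) + 1) ^ 2 * ((d : ℝ) + 4)) * α₀)
      * (1 + 8 * (131072 * ((d : ℝ) + 1) ^ 2) * ((L : ℝ) ^ k * b)) ≤ 2)
    (hc₃ : 2 * ((L : ℝ) ^ k * b) ≤ c3 d L) (hs : 128 * (d : ℝ) * ((L : ℝ) ^ k * b) ≤ 1) (hL1 : 1 ≤ L) :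
    InLambda L U₀ (glev L hL1 U₀ (expCfg B) k 0) k (40 * d * ((L : ℝ) ^ k * b)) (((L : ℝ) ^ k)⁻¹) :=
  inLambda_general hL hG hU₀ hα hα3 hα4 h52 hb hB hsmall hc₃ hs (axialGauge_glev L hL1 U₀ (expCfg B) k)
    (eq81_glev L hL1 U₀ (expCfg B) k)

/-- **(166) at `j = 0`: the gauge transformation itself is close to `1`.**  In the regime of the header, every solution
`u` of (67) + (81) relative to `U₀`, `U₁ = e^{B}`, `|B| ≤ b` satisfies `|u(x) − 1| ≤ 40d·L^k b` at EVERY site `x`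
(`\overline{R₀u}^0 = u`).  This is the form in which «the equalities and bounds (106)–(108), (159)–(163) in [12]» enter
[Balaban1989LargeFieldI] (1.37) and [Balaban1988Convergent] (3.19): the gauge transformation accompanying a small field
`e^{B}` is within `O(1)·L^k b` of `1`, `L^k b` = the sup of the exponent in the units of the `k`-th lattice.
[cite: Balaban1985Averaging, (166) p.44 (j = 0), (106) p.33] -/
theorem norm_sub_one_le_of_gaugeFixing (hL : 2 ≤ L) (hG : AvgClosed d L G) (hU₀ : ∀ x κ, U₀ x κ ∈ G) (hα : 0 < α₀)
    (hα3 : C0 d * α₀ ≤ 1 / 3) (hα4 : 4 * α₀ ≤ c2' d L) (h52 : pdev U₀ < α₀ * (((L : ℝ) ^ k)⁻¹) ^ 2)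
    (hb : 0 ≤ b) (hB : ∀ x κ, ‖B x κ‖ ≤ b)
    (hsmall : Real.exp (4 * (800 * ((d : ℝ) + 1) ^ 2 * ((d : ℝ) + 4)) * α₀)
      * (1 + 8 * (131072 * ((d : ℝ) + 1) ^ 2) * ((L : ℝ) ^ k * b)) ≤ 2)
    (hc₃ : 2 * ((L : ℝ) ^ k * b) ≤ c3 d L) (hs : 128 * (d : ℝ) * ((L : ℝ) ^ k * b) ≤ 1)
    {u : Site d → 𝔸ˣ} (hax : B7Eq84Concrete.AxialGauge L U₀ (expCfg B) u k) (h81 : ∀ z : Site d, uavg L U₀ u k z = 1)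
    (x : Site d) : ‖((u x : 𝔸ˣ) : 𝔸) - 1‖ ≤ 40 * d * ((L : ℝ) ^ k * b) := by
  have h := (inLambda_general hL hG hU₀ hα hα3 hα4 h52 hb hB hsmall hc₃ hs hax h81).1 0 (Nat.zero_le k) x
  rwa [uavg_zero] at h

/-- The same for the constructed gauge fixing `glev … k 0` ((104)–(106)): `|u(x) − 1| ≤ 40d·L^k b` at every site.
[cite: Balaban1985Averaging, (166) p.44 (j = 0), (104)–(106) p.33] -/
theorem norm_glev_sub_one_le (hL : 2 ≤ L) (hG : AvgClosed d L G) (hU₀ : ∀ x κ, U₀ x κ ∈ G) (hα : 0 < α₀)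
    (hα3 : C0 d * α₀ ≤ 1 / 3) (hα4 : 4 * α₀ ≤ c2' d L) (h52 : pdev U₀ < α₀ * (((L : ℝ) ^ k)⁻¹) ^ 2)
    (hb : 0 ≤ b) (hB : ∀ x κ, ‖B x κ‖ ≤ b)
    (hsmall : Real.exp (4 * (800 * ((d : ℝ) + 1) ^ 2 * ((d : ℝ) + 4)) * α₀)
      * (1 + 8 * (131072 * ((d : ℝ) + 1) ^ 2) * ((L : ℝ) ^ k * b)) ≤ 2)
    (hc₃ : 2 * ((L : ℝ) ^ k * b) ≤ c3 d L) (hs : 128 * (d : ℝ) * ((L : ℝ) ^ k * b) ≤ 1) (hL1 : 1 ≤ L)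
    (x : Site d) : ‖((glev L hL1 U₀ (expCfg B) k 0 x : 𝔸ˣ) : 𝔸) - 1‖ ≤ 40 * d * ((L : ℝ) ^ k * b) :=
  norm_sub_one_le_of_gaugeFixing hL hG hU₀ hα hα3 hα4 h52 hb hB hsmall hc₃ hs (axialGauge_glev L hL1 U₀ (expCfg B) k)
    (eq81_glev L hL1 U₀ (expCfg B) k) x

/-- **In print's letters** (`η = L^{−k}`, «|U₁ − 1| < α₁η» read as `U₁ = e^{B}`, `|B| ≤ α₁η`): if `L^kη = 1` and `α₁` satisfies
the regime's smallness in place of `L^k b`, every solution of (67) + (81) at the regular background `U₀` lies in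
`Λ_k(U₀, α₃)` with the EXPLICIT `α₃ = 40d·α₁` — print's "if the configuration `U₁` is small … `α₁` small" with the `O(1)` made
a number, now at a curved background. [cite: Balaban1985Averaging, p.43 (Sect. F, paragraph after (165)), (166)–(167) p.44] -/
theorem inLambda_general_eta (hL : 2 ≤ L) (hG : AvgClosed d L G) (hU₀ : ∀ x κ, U₀ x κ ∈ G) (hα : 0 < α₀)
    (hα3 : C0 d * α₀ ≤ 1 / 3) (hα4 : 4 * α₀ ≤ c2' d L) (h52 : pdev U₀ < α₀ * (((L : ℝ) ^ k)⁻¹) ^ 2)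
    {η α₁ : ℝ} (hη : (L : ℝ) ^ k * η = 1) (hα₁ : 0 ≤ α₁) (hBη : ∀ x κ, ‖B x κ‖ ≤ η * α₁)
    (hsmall : Real.exp (4 * (800 * ((d : ℝ) + 1) ^ 2 * ((d : ℝ) + 4)) * α₀)
      * (1 + 8 * (131072 * ((d : ℝ) + 1) ^ 2) * α₁) ≤ 2)
    (hc₃ : 2 * α₁ ≤ c3 d L) (hs : 128 * (d : ℝ) * α₁ ≤ 1)
    {u : Site d → 𝔸ˣ} (hax : B7Eq84Concrete.AxialGauge L U₀ (expCfg B) u k) (h81 : ∀ z : Site d, uavg L U₀ u k z = 1) :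
    InLambda L U₀ u k (40 * d * α₁) η := by
  have hLk : (0 : ℝ) < (L : ℝ) ^ k := by positivity
  have hη' : η = ((L : ℝ) ^ k)⁻¹ := (inv_eq_of_mul_eq_one_right hη).symm
  have hηpos : 0 < η := by rw [hη']; positivity
  have hb' : 0 ≤ η * α₁ := by positivity
  have hkey : (L : ℝ) ^ k * (η * α₁) = α₁ := by rw [← mul_assoc, hη, one_mul]
  have := inLambda_general hL hG hU₀ hα hα3 hα4 h52 hb' hBη (by rw [hkey]; exact hsmall) (by rw [hkey]; exact hc₃)
    (by rw [hkey]; exact hs) hax h81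
  rw [hkey, ← hη'] at this
  exact this

end Tower

end Literature.MathematicalPhysics.QuantumFieldTheory.Balaban1983to89.B7Eq167General

end
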